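import Summits.ResolutionOfSingularities.ResolutionOfSingularities.Theorems.EquisingularLiftEquisingularLiftNatSpecimenFermatConeCharts
import Summits.ResolutionOfSingularities.ResolutionOfSingularities.Theorems.EquisingularLiftEquisingularLiftNatLinearCentrePoints
import Summits.ResolutionOfSingularities.ResolutionOfSingularities.Theorems.EquisingularLiftEquisingularLiftStrictTransformBlowupModel
import Summits.ResolutionOfSingularities.ResolutionOfSingularities.Theorems.EquisingularLiftEquisingularLiftLinearCentreOfCharts
import Literature.AlgebraicGeometry.Resolution.EmbeddedResolutionCentre
import Literature.AlgebraicGeometry.Resolution.AffineBlowupIntegral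
import Literature.AlgebraicGeometry.Resolution.BlowupsExistence
import Literature.AlgebraicGeometry.Motives.ProjectiveSpaceLinearSubspaces
import Mathlib.LinearAlgebra.Matrix.Determinant.Basic
import HarnessLib

/-!
# [OURS · L1 W4.5(b)] EL♮ specimen family T-ISO-CONE — the FERMAT CONES satisfy the downstairs hypothesis of the REGISTERED stub
# `stub_elnat_ciNoseThenPoints` («smooth complete-intersection nose, then points»; skeleton v6 of res-L1-w45b-lead-2, 2026-08-27T08:54:27Z)
# — a NON-VACUITY certificate for that stub at `n = 3` (crux `EquisingularLiftNat`, stmt-ResolutionOfSingularities-20038 / child stmt-20148)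

NOT a statement of any manuscript; OURS kernel specimen (cell `res-hironaka`, chain w45b; seat res-D-pv-013, own initiative, counted 0).
AI-written, weaker than expert review.

For `H = H_d = V₊(x₁ᵈ + x₂ᵈ + x₃ᵈ) ⊂ ℙ³_k` (`k` algebraically closed, `d ≠ 0` in `k`; `…FermatConeForms/Charts`) the DOWNSTAIRS hypothesis of
`stub_elnat_ciNoseThenPoints` (TARGET-CINOSE.lean 9810b78bf486e457, VERBATIM at `n = 3`) holds with

* `c = 3`, `f = (x₁, x₂, x₃)`, degrees `(1, 1, 1)` — so `Σ = {y | x₁, x₂, x₃ ∈ 𝔭_y} = {[1:0:0:0]}` is the VERTEX: nonempty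
  (`Motives.ProjectiveSpace.coordSubspacePoint {1,2,3}`), `Σ ⊆ ι(H)` (`F_d ∈ (x₁, x₂, x₃)`), `ι(H) ⊄ Σ` (the generic point `(F_d)`), the
  Jacobian minor for `e = Fin.succ` is `det 1 = 1 ∉ 𝔭_y`;
* `υ : F₂ → ℙ³_k` a blow-up along `vanishingIdeal Σ` — which EQUALS the kill-map ideal sheaf `Λ = ker Proj(f_k)` of `…FermatConeCharts`
  (`ker_projMap_kill_eq_vanishingIdeal`: `Λ = 𝓘(closure (range Proj(f_k)))` for the reduced source `ℙ⁰_k`, tree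
  `ker_eq_vanishingIdeal_of_isReduced`, and `range Proj(f_k) = Σ`, `range_projMap_kill_eq`);
* ZERO point steps: the reduced strict transform `V(closure υ⁻¹(ι(H) ∖ Σ))_red` is ALREADY REGULAR — it is a blow-up of `H` along `Λ · 𝒪_H`
  (tree `LinearCentre.isRegular_reducedStrictTransform_of_blowupModel`, Hartshorne II 7.15) and every such blow-up is regular
  (`FermatCone.isRegular_of_isBlowup_comap`, file …FermatConeCharts).

`ciNoseThenPoints_hypothesis_fermatCone` is that `∃ (c, f, d, …)` block; composed with a closed `stub_elnat_ciNoseThenPoints` (INSTANCE ROUTE (L1) ∘ (051-horiz),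
res-L1-w45b-lead-2 08:54:27Z) it gives a second proof of `elNatAt_fermatCone`, and today it certifies that the registered stub's hypothesis is
SATISFIABLE at `n = 3` by an `H` with an isolated singular point.
-/

set_option linter.dupNamespace false -- mandated namespace `Summit.<Summit>.<Problem>` of this single-conjunct summit

noncomputable section

open CategoryTheory CategoryTheory.Limits AlgebraicGeometry TopologicalSpace
open MvPolynomial HomogeneousLocalization
open Literature.AlgebraicGeometry.Resolution
open Literature.AlgebraicGeometry.Motives Literature.AlgebraicGeometry.Motives.SmoothHypersurface
open Literature.AlgebraicGeometry.Motives.ProjectiveSpace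
open AlgebraicGeometry.Scheme.IdealSheafData
open Summit.ResolutionOfSingularities.ResolutionOfSingularities.Cruxes.EquisingularLift.StrataSplit

namespace Summit.ResolutionOfSingularities.ResolutionOfSingularities.Cruxes.EquisingularLiftNat.Sections

namespace FermatCone

variable (k : Type) [Field k] (deg : ℕ)

attribute [local instance] MvPolynomial.gradedAlgebra ProjBaseChange.algebraBase

/-! ## The vertex set `Σ = {y | x₁, x₂, x₃ ∈ 𝔭_y}` -/

/-- `Σ = {y | x₁, x₂, x₃ ∈ 𝔭_y}` is the zero locus `V₊(x₁, x₂, x₃)`. [folklore] -/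
theorem sigma_eq_zeroLocus :
    {y : (Literature.AlgebraicGeometry.Motives.projectiveSpace 3 k).left |
      ∀ i, (![X 1, X 2, X 3] : Fin 3 → MvPolynomial (Fin (3 + 1)) k) i ∈
        (y : ProjectiveSpectrum (MvPolynomial.homogeneousSubmodule (Fin (3 + 1)) k)).asHomogeneousIdeal} =
      ProjectiveSpectrum.zeroLocus (MvPolynomial.homogeneousSubmodule (Fin (3 + 1)) k)
        (X '' ((({1, 2, 3} : Finset (Fin (3 + 1))) : Set (Fin (3 + 1))))) := by
  ext y
  refine Iff.trans ?_ (ProjectiveSpectrum.mem_zeroLocus _ _ _).symm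
  rw [Set.image_subset_iff]
  simp only [Finset.coe_insert, Finset.coe_singleton, Fin.forall_fin_succ, IsEmpty.forall_iff, Matrix.cons_val_zero,
    Matrix.cons_val_succ, and_true, Set.insert_subset_iff, Set.singleton_subset_iff, Set.mem_preimage, SetLike.mem_coe,
    Set.mem_setOf_eq]

/-- `Σ` is closed. [folklore] -/
theorem isClosed_sigma :
    IsClosed {y : (Literature.AlgebraicGeometry.Motives.projectiveSpace 3 k).left |
      ∀ i, (![X 1, X 2, X 3] : Fin 3 → MvPolynomial (Fin (3 + 1)) k) i ∈
        (y : ProjectiveSpectrum (MvPolynomial.homogeneousSubmodule (Fin (3 + 1)) k)).asHomogeneousIdeal} := by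
  rw [sigma_eq_zeroLocus]
  exact ProjectiveSpectrum.isClosed_zeroLocus _ _

/-- The proper subset `{1, 2, 3}` of the coordinates. [folklore] -/
theorem finset_ne_univ : ({1, 2, 3} : Finset (Fin (3 + 1))) ≠ Finset.univ := by decide

/-- `Σ` is the closure of the vertex point `(x₁, x₂, x₃) ∈ ℙ³_k` (`coordSubspacePoint`). [folklore] -/
theorem sigma_eq_closure_vertex :
    {y : (Literature.AlgebraicGeometry.Motives.projectiveSpace 3 k).left |
      ∀ i, (![X 1, X 2, X 3] : Fin 3 → MvPolynomial (Fin (3 + 1)) k) i ∈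
        (y : ProjectiveSpectrum (MvPolynomial.homogeneousSubmodule (Fin (3 + 1)) k)).asHomogeneousIdeal} =
      closure {coordSubspacePoint (k := k) ({1, 2, 3} : Finset (Fin (3 + 1))) (finset_ne_univ)} := by
  rw [sigma_eq_zeroLocus, closure_coordSubspacePoint]

/-- The vertex point lies in `Σ`; in particular `Σ` is nonempty. [folklore] -/
theorem vertex_mem_sigma :
    coordSubspacePoint (k := k) ({1, 2, 3} : Finset (Fin (3 + 1))) finset_ne_univ ∈
      {y : (Literature.AlgebraicGeometry.Motives.projectiveSpace 3 k).left |
        ∀ i, (![X 1, X 2, X 3] : Fin 3 → MvPolynomial (Fin (3 + 1)) k) i ∈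
          (y : ProjectiveSpectrum (MvPolynomial.homogeneousSubmodule (Fin (3 + 1)) k)).asHomogeneousIdeal} := by
  rw [sigma_eq_closure_vertex]
  exact subset_closure rfl

/-! ## `Σ` is the support of the kill-map centre `Λ = ker Proj(f_k)`, and `Λ = 𝓘(Σ)` -/

section Kill

variable (fk : homogeneousSubmodule (Fin (0 + 3 + 1)) k →+*ᵍ homogeneousSubmodule (Fin (0 + 1)) k)
  (hfk' : HomogeneousIdeal.irrelevant (homogeneousSubmodule (Fin (0 + 1)) k) ≤
    (HomogeneousIdeal.irrelevant (homogeneousSubmodule (Fin (0 + 3 + 1)) k)).map fk) (hfkC : ∀ a : k, fk (C a) = C a)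
  (hfkX : ∀ i : Fin (0 + 3 + 1), fk (X i) = if h : (i : ℕ) < 0 + 1 then X ⟨i, h⟩ else 0)

include hfkC hfkX in
/-- `range Proj(f_k) ⊆ Σ`: the killed variables vanish on the image. [folklore] -/
theorem range_projMap_kill_subset_sigma :
    Set.range (Proj.map fk hfk') ⊆
      {y : (Literature.AlgebraicGeometry.Motives.projectiveSpace 3 k).left |
        ∀ i, (![X 1, X 2, X 3] : Fin 3 → MvPolynomial (Fin (3 + 1)) k) i ∈
          (y : ProjectiveSpectrum (MvPolynomial.homogeneousSubmodule (Fin (3 + 1)) k)).asHomogeneousIdeal} := by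
  intro y hy
  have hy' := (Proj.map fk hfk').range_subset_ker_support hy
  have h1 := X_mem_of_mem_support k fk hfk' hfkC hfkX hy' 1 (by decide)
  have h2 := X_mem_of_mem_support k fk hfk' hfkC hfkX hy' 2 (by decide)
  have h3 := X_mem_of_mem_support k fk hfk' hfkC hfkX hy' 3 (by decide)
  intro i
  fin_cases i
  · exact h1
  · exact h2
  · exact h3

include hfkC hfkX in
/-- **The vertex is the image of the (unique) point of `ℙ⁰_k`**: `Proj(f_k)` takes the generic point `(0)` of `Proj k[x₀]` to the point
`(x₁, x₂, x₃) = ker f_k` of `ℙ³_k`. [folklore] -/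
theorem vertex_mem_range_projMap_kill :
    coordSubspacePoint (k := k) ({1, 2, 3} : Finset (Fin (3 + 1))) finset_ne_univ ∈ Set.range (Proj.map fk hfk') := by
  -- the generic point of `ℙ⁰_k = Proj k[x₀]`: the zero ideal (prime, homogeneous, relevant since `x₀ ∉ (0)`)
  let y₀ : Proj (homogeneousSubmodule (Fin (0 + 1)) k) :=
    ⟨⊥, Ideal.isPrime_bot, fun h => by
      have hX : (X 0 : MvPolynomial (Fin (0 + 1)) k) ∈ HomogeneousIdeal.irrelevant (homogeneousSubmodule (Fin (0 + 1)) k) :=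
        HomogeneousIdeal.mem_irrelevant_of_mem _ zero_lt_one (EquisingularLift.StrataSplit.LinearCentre.X_mem_one (r := 0) (m := 0) 0)
      have h0 : (X 0 : MvPolynomial (Fin (0 + 1)) k) ∈ (⊥ : HomogeneousIdeal (homogeneousSubmodule (Fin (0 + 1)) k)) := h hX
      rw [← HomogeneousIdeal.mem_iff, HomogeneousIdeal.toIdeal_bot, Ideal.mem_bot] at h0
      exact X_ne_zero (R := k) (0 : Fin (0 + 1)) h0⟩
  refine ⟨y₀, ?_⟩
  apply ProjectiveSpectrum.ext
  apply HomogeneousIdeal.toIdeal_injective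
  rw [LinearCentre.projMap_apply_asHomogeneousIdeal, HomogeneousIdeal.toIdeal_comap, toIdeal_coordSubspacePoint]
  change Ideal.comap fk.toRingHom ⊥ = _
  rw [← RingHom.ker_eq_comap_bot, EquisingularLift.StrataSplit.LinearCentre.ker_kill (r := 0) (m := 3) fk.toRingHom (fun a => hfkC a) (fun i => hfkX i)]
  have hidx : {i : Fin (0 + 3 + 1) | 0 + 1 ≤ (i : ℕ)} = ((({1, 2, 3} : Finset (Fin (3 + 1))) : Set (Fin (3 + 1)))) := by
    ext i
    fin_cases i <;> simp
  rw [hidx]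

include hfkC hfkX in
/-- **`range Proj(f_k) = Σ`**: the image is closed and contains the vertex, whose closure is `Σ`. [folklore] -/
theorem range_projMap_kill_eq :
    Set.range (Proj.map fk hfk') =
      {y : (Literature.AlgebraicGeometry.Motives.projectiveSpace 3 k).left |
        ∀ i, (![X 1, X 2, X 3] : Fin 3 → MvPolynomial (Fin (3 + 1)) k) i ∈
          (y : ProjectiveSpectrum (MvPolynomial.homogeneousSubmodule (Fin (3 + 1)) k)).asHomogeneousIdeal} := by
  haveI : IsClosedImmersion (Proj.map fk hfk') :=
    Literature.AlgebraicGeometry.FundamentalGroup.isClosedImmersion_projMap_of_surjective fk hfk'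
      (EquisingularLift.StrataSplit.LinearCentre.kill_surjective (r := 0) (m := 3) fk.toRingHom (fun a => hfkC a) (fun i => hfkX i))
  refine (range_projMap_kill_subset_sigma k fk hfk' hfkC hfkX).antisymm fun y hy => ?_
  have hy' := ((Set.ext_iff.mp (sigma_eq_closure_vertex k)) y).mp hy
  exact closure_minimal (Set.singleton_subset_iff.mpr (vertex_mem_range_projMap_kill k fk hfk' hfkC hfkX))
    (Proj.map fk hfk').isClosedEmbedding.isClosed_range hy'

include hfkC hfkX in
/-- `supp Λ = Σ` for `Λ = ker Proj(f_k)`. [folklore] -/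
theorem support_ker_projMap_kill_eq :
    ((Proj.map fk hfk').ker.support : Set (Proj (homogeneousSubmodule (Fin (0 + 3 + 1)) k))) =
      {y : (Literature.AlgebraicGeometry.Motives.projectiveSpace 3 k).left |
        ∀ i, (![X 1, X 2, X 3] : Fin 3 → MvPolynomial (Fin (3 + 1)) k) i ∈
          (y : ProjectiveSpectrum (MvPolynomial.homogeneousSubmodule (Fin (3 + 1)) k)).asHomogeneousIdeal} := by
  rw [Scheme.Hom.support_ker, range_projMap_kill_eq k fk hfk' hfkC hfkX]
  exact (isClosed_sigma k).closure_eq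

include hfkC hfkX in
/-- **`Λ = ker Proj(f_k)` IS the vanishing ideal sheaf of `Σ`** (the source `ℙ⁰_k` is reduced, so the kernel is the ideal sheaf of the closure
of the image: tree `ker_eq_vanishingIdeal_of_isReduced`; and that closure is `Σ`). [folklore] -/
theorem ker_projMap_kill_eq_vanishingIdeal
    (hS : IsClosed {y : (Literature.AlgebraicGeometry.Motives.projectiveSpace 3 k).left |
      ∀ i, (![X 1, X 2, X 3] : Fin 3 → MvPolynomial (Fin (3 + 1)) k) i ∈
        (y : ProjectiveSpectrum (MvPolynomial.homogeneousSubmodule (Fin (3 + 1)) k)).asHomogeneousIdeal}) :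
    (Proj.map fk hfk').ker = vanishingIdeal ⟨_, hS⟩ := by
  haveI : IsReduced (Proj (homogeneousSubmodule (Fin (0 + 1)) k)) := Proj.isReduced _
  rw [ker_eq_vanishingIdeal_of_isReduced]
  congr 1
  apply Closeds.ext
  change closure (Set.range (Proj.map fk hfk')) = _
  rw [range_projMap_kill_eq k fk hfk' hfkC hfkX]
  exact hS.closure_eq

end Kill

/-! ## The remaining clauses of the hypothesis -/

/-- `Σ ⊆ ι(H_d)`: `F_d = x₁ᵈ + x₂ᵈ + x₃ᵈ ∈ 𝔭_y` whenever `x₁, x₂, x₃ ∈ 𝔭_y` (`d ≥ 1`). [folklore] -/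
theorem sigma_subset_range_ι (hd : 0 < deg) :
    {y : (Literature.AlgebraicGeometry.Motives.projectiveSpace 3 k).left |
      ∀ i, (![X 1, X 2, X 3] : Fin 3 → MvPolynomial (Fin (3 + 1)) k) i ∈
        (y : ProjectiveSpectrum (MvPolynomial.homogeneousSubmodule (Fin (3 + 1)) k)).asHomogeneousIdeal} ⊆
      Set.range (hypersurfaceι (form k deg)).left := by
  intro y hy
  have h1 : (X 1 : MvPolynomial (Fin (3 + 1)) k) ∈ y.asHomogeneousIdeal := hy 0
  have h2 : (X 2 : MvPolynomial (Fin (3 + 1)) k) ∈ y.asHomogeneousIdeal := hy 1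
  have h3 : (X 3 : MvPolynomial (Fin (3 + 1)) k) ∈ y.asHomogeneousIdeal := hy 2
  refine (Set.ext_iff.mp (range_hypersurfaceι (form k deg)) y).mpr
    ((ProjectiveSpectrum.mem_zeroLocus _ _ _).mpr (Set.singleton_subset_iff.mpr ?_))
  change form k deg ∈ y.asHomogeneousIdeal
  rw [form]
  exact Ideal.add_mem _ (Ideal.add_mem _ (Ideal.pow_mem_of_mem _ h1 deg hd) (Ideal.pow_mem_of_mem _ h2 deg hd))
    (Ideal.pow_mem_of_mem _ h3 deg hd)

/-- `ι(H_d) ⊄ Σ`: the generic point `(F_d)` of `H_d` does not contain `x₁`. [folklore] -/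
theorem not_range_ι_subset_sigma [IsAlgClosed k] (hdk : (deg : k) ≠ 0) :
    ¬ (Set.range (hypersurfaceι (form k deg)).left ⊆
      {y : (Literature.AlgebraicGeometry.Motives.projectiveSpace 3 k).left |
        ∀ i, (![X 1, X 2, X 3] : Fin 3 → MvPolynomial (Fin (3 + 1)) k) i ∈
          (y : ProjectiveSpectrum (MvPolynomial.homogeneousSubmodule (Fin (3 + 1)) k)).asHomogeneousIdeal}) := by
  intro h
  have hmem : (pointOfPrime (form k deg) (isHomogeneous_form k deg) (prime_form k deg hdk) :
      Proj (homogeneousSubmodule (Fin (3 + 1)) k)) ∈ Set.range (hypersurfaceι (form k deg)).left := by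
    refine (Set.ext_iff.mp (range_hypersurfaceι (form k deg)) _).mpr
      ((ProjectiveSpectrum.mem_zeroLocus _ _ _).mpr (Set.singleton_subset_iff.mpr ?_))
    exact Ideal.subset_span rfl
  have h1 : (X 1 : MvPolynomial (Fin 4) k) ∈ Ideal.span {form k deg} := (h hmem) 0
  exact X_one_not_mem_span_form k deg hdk h1

/-- **The Jacobian clause**: with `e = Fin.succ : Fin 3 ↪ Fin 4` the minor `(∂x_{i+1}/∂x_{j+1})` is the identity matrix, whose
determinant `1` lies in no point's (proper) ideal. [folklore] -/
theorem jacobian_clause (y : (Literature.AlgebraicGeometry.Motives.projectiveSpace 3 k).left) :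
    ∃ e : Fin 3 ↪ Fin (3 + 1), Matrix.det (Matrix.of fun i j =>
      MvPolynomial.pderiv (e j) ((![X 1, X 2, X 3] : Fin 3 → MvPolynomial (Fin (3 + 1)) k) i)) ∉
        (y : ProjectiveSpectrum (MvPolynomial.homogeneousSubmodule (Fin (3 + 1)) k)).asHomogeneousIdeal := by
  refine ⟨⟨Fin.succ, Fin.succ_injective _⟩, ?_⟩
  have hM : (Matrix.of fun i j : Fin 3 =>
      MvPolynomial.pderiv ((⟨Fin.succ, Fin.succ_injective _⟩ : Fin 3 ↪ Fin (3 + 1)) j)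
        ((![X 1, X 2, X 3] : Fin 3 → MvPolynomial (Fin (3 + 1)) k) i)) = 1 := by
    ext i j
    fin_cases i <;> fin_cases j <;> simp [pderiv_X]
  rw [hM, Matrix.det_one]
  exact fun h1 => y.isPrime.ne_top ((Ideal.eq_top_iff_one _).mpr h1)

/-! ## The certificate -/

/-- **THE FERMAT CONES SATISFY THE DOWNSTAIRS HYPOTHESIS OF `stub_elnat_ciNoseThenPoints` AT `n = 3`** (`k` algebraically closed of
characteristic `p`, `d ≠ 0` in `k`): the `∃ (c, f, d, …)` block of the registered stub (TARGET-CINOSE 9810b78bf486e457, skeleton v6) for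
`H = H_d`, `ι = hypersurfaceι F_d`, witnessed by `c = 3`, `f = (x₁, x₂, x₃)`, degrees `(1,1,1)` (`Σ` = the vertex), a blow-up `υ` of `ℙ³_k`
along `𝓘(Σ) = ker Proj(f_k)`, and ZERO point steps — the reduced strict transform `V(closure υ⁻¹(ι(H) ∖ Σ))_red` is a blow-up of `H_d` along
`Λ · 𝒪_H` (tree `isRegular_reducedStrictTransform_of_blowupModel`), hence regular by `isRegular_of_isBlowup_comap`. Non-vacuity certificate for
the registered stub; composes with its closure to a second proof of `elNatAt_fermatCone`. [OURS · L1 W4.5b] [folklore] -/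
theorem ciNoseThenPoints_hypothesis_fermatCone (p : ℕ) (K : Type) [Field K] [CharP K p] [IsAlgClosed K]
    (hdK : (deg : K) ≠ 0) :
    (letI := MvPolynomial.gradedAlgebra (σ := Fin (3 + 1)) (R := K); ∃ (c : ℕ) (f : Fin c → MvPolynomial (Fin (3 + 1)) K) (d : Fin c → ℕ), (∀ i, 1 ≤ d i ∧ f i ∈ MvPolynomial.homogeneousSubmodule (Fin (3 + 1)) K (d i)) ∧ Set.Nonempty {y : (Literature.AlgebraicGeometry.Motives.projectiveSpace 3 K).left | ∀ i, f i ∈ (y : ProjectiveSpectrum (MvPolynomial.homogeneousSubmodule (Fin (3 + 1)) K)).asHomogeneousIdeal} ∧ {y : (Literature.AlgebraicGeometry.Motives.projectiveSpace 3 K).left | ∀ i, f i ∈ (y : ProjectiveSpectrum (MvPolynomial.homogeneousSubmodule (Fin (3 + 1)) K)).asHomogeneousIdeal} ⊆ Set.range (Literature.AlgebraicGeometry.Motives.SmoothHypersurface.hypersurfaceι (form K deg)).left ∧ ¬ (Set.range (Literature.AlgebraicGeometry.Motives.SmoothHypersurface.hypersurfaceι (form K deg)).left ⊆ {y : (Literature.AlgebraicGeometry.Motives.projectiveSpace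 3 K).left | ∀ i, f i ∈ (y : ProjectiveSpectrum (MvPolynomial.homogeneousSubmodule (Fin (3 + 1)) K)).asHomogeneousIdeal}) ∧ (∀ y ∈ {y : (Literature.AlgebraicGeometry.Motives.projectiveSpace 3 K).left | ∀ i, f i ∈ (y : ProjectiveSpectrum (MvPolynomial.homogeneousSubmodule (Fin (3 + 1)) K)).asHomogeneousIdeal}, ∃ e : Fin c ↪ Fin (3 + 1), Matrix.det (Matrix.of fun i j => MvPolynomial.pderiv (e j) (f i)) ∉ (y : ProjectiveSpectrum (MvPolynomial.homogeneousSubmodule (Fin (3 + 1)) K)).asHomogeneousIdeal) ∧ ∃ (hSig : IsClosed {y : (Literature.AlgebraicGeometry.Motives.projectiveSpace 3 K).left | ∀ i, f i ∈ (y : ProjectiveSpectrum (MvPolynomial.homogeneousSubmodule (Fin (3 + 1)) K)).asHomogeneousIdeal}) (F₂ : AlgebraicGeometry.Scheme.{0}) (υ : F₂ ⟶ (Literature.AlgebraicGeometry.Motives.projectiveSpace 3 K).left), Literature.AlgebraicGeometry.Resolution.IsBlowup υ (AlgebraicGeometry.Scheme.IdealSheafData.vanishingIdeal (⟨{y : (Literature.AlgebraicGeometry.Motives.projectiveSpace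 3 K).left | ∀ i, f i ∈ (y : ProjectiveSpectrum (MvPolynomial.homogeneousSubmodule (Fin (3 + 1)) K)).asHomogeneousIdeal}, hSig⟩ : TopologicalSpace.Closeds (Literature.AlgebraicGeometry.Motives.projectiveSpace 3 K).left)) ∧ ∃ (F' : AlgebraicGeometry.Scheme.{0}) (ρ' : F' ⟶ F₂) (T' : Set F'), (∀ Q : (∀ F₁ : AlgebraicGeometry.Scheme.{0}, (F₁ ⟶ F₂) → Set F₁ → Prop), Q F₂ (CategoryTheory.CategoryStruct.id F₂) (closure (υ ⁻¹' (Set.range (Literature.AlgebraicGeometry.Motives.SmoothHypersurface.hypersurfaceι (form K deg)).left \ {y : (Literature.AlgebraicGeometry.Motives.projectiveSpace 3 K).left | ∀ i, f i ∈ (y : ProjectiveSpectrum (MvPolynomial.homogeneousSubmodule (Fin (3 + 1)) K)).asHomogeneousIdeal}))) → (∀ (F₁ F₃ : AlgebraicGeometry.Scheme.{0}) (ρ : F₁ ⟶ F₂) (T₁ : Set F₁) (x : ↥((AlgebraicGeometry.Scheme.IdealSheafData.vanishingIdeal (⟨closure T₁, isClosed_closure⟩ : TopologicalSpace.Closeds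 F₁))).subscheme) (υ₁ : F₃ ⟶ F₁) (hx : IsClosed ({(((AlgebraicGeometry.Scheme.IdealSheafData.vanishingIdeal (⟨closure T₁, isClosed_closure⟩ : TopologicalSpace.Closeds F₁))).subschemeι x : F₁)} : Set F₁)), Q F₁ ρ T₁ → ¬ IsRegularLocalRing (((AlgebraicGeometry.Scheme.IdealSheafData.vanishingIdeal (⟨closure T₁, isClosed_closure⟩ : TopologicalSpace.Closeds F₁))).subscheme.presheaf.stalk x) → Literature.AlgebraicGeometry.Resolution.IsBlowup υ₁ (AlgebraicGeometry.Scheme.IdealSheafData.vanishingIdeal (⟨{(((AlgebraicGeometry.Scheme.IdealSheafData.vanishingIdeal (⟨closure T₁, isClosed_closure⟩ : TopologicalSpace.Closeds F₁))).subschemeι x : F₁)}, hx⟩ : TopologicalSpace.Closeds F₁)) → Q F₃ (CategoryTheory.CategoryStruct.comp υ₁ ρ) (closure (υ₁ ⁻¹' (T₁ \ {(((AlgebraicGeometry.Scheme.IdealSheafData.vanishingIdeal (⟨closure T₁, isClosed_closure⟩ : TopologicalSpace.Closeds F₁))).subschemeι x : F₁)})))) → Q F' ρ' T') ∧ Literature.AlgebraicGeometry.Resolution.Scheme.IsRegular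 (AlgebraicGeometry.Scheme.IdealSheafData.vanishingIdeal (⟨closure T', isClosed_closure⟩ : TopologicalSpace.Closeds F')).subscheme) := by
  classical
  have hd : 0 < deg := Nat.pos_of_ne_zero (by rintro rfl; exact hdK (by simp))
  obtain ⟨fk, hfk', hfkC, hfkX⟩ := EquisingularLift.StrataSplit.LinearCentre.exists_kill K 0 3
  haveI := isIntegral_hypersurface K deg hdK
  haveI : IsLocallyNoetherian (Literature.AlgebraicGeometry.Motives.projectiveSpace (2 + 1) K).left :=
    EquisingularLift.StrataSplit.LinearCentre.isLocallyNoetherian_proj K (0 + 3)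
  -- the blow-up of `ℙ³_k` along `Λ = ker Proj(f_k) = 𝓘(Σ)`
  obtain ⟨F₂, υ, hυ⟩ := exists_isBlowup (Proj (homogeneousSubmodule (Fin (0 + 3 + 1)) K)) (Proj.map fk hfk').ker
  have hΛ := ker_projMap_kill_eq_vanishingIdeal K fk hfk' hfkC hfkX (isClosed_sigma K)
  have hsupp := support_ker_projMap_kill_eq K fk hfk' hfkC hfkX
  -- the reduced strict transform is regular (zero point steps)
  have hreg : Scheme.IsRegular (vanishingIdeal (⟨closure (υ ⁻¹' (Set.range (hypersurfaceι (form K deg)).left \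
      ((Proj.map fk hfk').ker.support : Set (Proj (homogeneousSubmodule (Fin (0 + 3 + 1)) K))))), isClosed_closure⟩ :
      Closeds F₂)).subscheme :=
    EquisingularLift.StrataSplit.LinearCentre.isRegular_reducedStrictTransform_of_blowupModel (hypersurfaceι (form K deg)).left (Proj.map fk hfk').ker
      (not_range_subset_support K deg fk hfk' hfkC hfkX hdK)
      (fun Z ρ hρ => isRegular_of_isBlowup_comap K deg fk hfk' hfkC hfkX hdK Z ρ hρ) υ hυ
  refine ⟨3, ![X 1, X 2, X 3], ![1, 1, 1], ?_, ⟨_, vertex_mem_sigma K⟩, sigma_subset_range_ι K deg hd,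
    not_range_ι_subset_sigma K deg hdK, fun y _ => jacobian_clause K y, isClosed_sigma K, F₂, υ, ?_, F₂, 𝟙 F₂, _,
    fun Q h0 _ => h0, ?_⟩
  · intro i
    fin_cases i <;> exact ⟨le_rfl, (mem_homogeneousSubmodule _ _).mpr (isHomogeneous_X K _)⟩
  · rw [← hΛ]
    exact hυ
  · rw [hsupp] at hreg
    have e : (⟨closure (closure (υ ⁻¹' (Set.range (hypersurfaceι (form K deg)).left \
        {y : (Literature.AlgebraicGeometry.Motives.projectiveSpace 3 K).left |
          ∀ i, (![X 1, X 2, X 3] : Fin 3 → MvPolynomial (Fin (3 + 1)) K) i ∈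
            (y : ProjectiveSpectrum (MvPolynomial.homogeneousSubmodule (Fin (3 + 1)) K)).asHomogeneousIdeal}))),
        isClosed_closure⟩ : Closeds F₂) = ⟨closure (υ ⁻¹' (Set.range (hypersurfaceι (form K deg)).left \
        {y : (Literature.AlgebraicGeometry.Motives.projectiveSpace 3 K).left |
          ∀ i, (![X 1, X 2, X 3] : Fin 3 → MvPolynomial (Fin (3 + 1)) K) i ∈
            (y : ProjectiveSpectrum (MvPolynomial.homogeneousSubmodule (Fin (3 + 1)) K)).asHomogeneousIdeal})),
        isClosed_closure⟩ := Closeds.ext closure_closure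
    have hreg' : Scheme.IsRegular (vanishingIdeal (⟨closure (closure (υ ⁻¹' (Set.range (hypersurfaceι (form K deg)).left \
        {y : (Literature.AlgebraicGeometry.Motives.projectiveSpace 3 K).left |
          ∀ i, (![X 1, X 2, X 3] : Fin 3 → MvPolynomial (Fin (3 + 1)) K) i ∈
            (y : ProjectiveSpectrum (MvPolynomial.homogeneousSubmodule (Fin (3 + 1)) K)).asHomogeneousIdeal}))),
        isClosed_closure⟩ : Closeds F₂)).subscheme := by
      rw [e]
      exact hreg
    exact hreg'

end FermatCone

end Summit.ResolutionOfSingularities.ResolutionOfSingularities.Cruxes.EquisingularLiftNat.Sections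

end
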